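import Summits.ValiantsHypothesis.ValiantsHypothesis.Theorems.BarrierLeverChowBenchmarkPairsDualisation

/-!
# Route BarrierLever — item 22038 `ChowBenchmarkPairs`, line `moore-peel`: a NO-GO for GENERAL point tables —
# points sharing one coordinate starve the segment-moment matrix (coordinate-hyperplane starvation)

Helper file (`--supports stmt-ValiantsHypothesis-22038`; cell valiant-natproofs, rung V4, 𝒟-side benchmark of
record; seat val-np-p4 gen 20).  Closes NO item; definition-light (two abbreviations for readability).

THE RULE.  Let `P : Fin h → Fin h → ℂ` be a point table (point `a` = row `P a`) and suppose that ALL points have the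
SAME `c₀`-th coordinate, `P a c₀ = v` for every `a` (any `v`, zero allowed).  Let
`N = #{j < r : c₀ ∈ benchCols h r j}` be the number of benchmark columns (binary codes `< r`) containing the bit `c₀`.
If `N ≥ h + 2` then the segment-moment matrix of the benchmark layout (rows = all subsets of size `≤ 2`, columns = the
first `r` binary codes; the matrix of the line's `SegmentMeanValueAt h` / `Stmt.stub_segmentMeanValue`) is SINGULAR
(`det_eq_zero_of_common_coordinate`), indeed of corank `≥ N - h - 1` (the proof bounds the rank by `r - N + h + 1`).
For the lowest bit `c₀ = 0` one has `N = ⌊r/2⌋`, so the rule bites at every height `h ≥ 5`; numerically the bound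
`N - h - 1` is the exact corank (h ≤ 12, kit j308240).

MECHANISM (the pair rows satisfy `N` universal linear equations).  For a pair row `{a,b}` the entry at a column
`T ∋ c₀` is determined by the entry at `T ∖ {c₀}`:
`segEntry P {a,b} T = v · (|T| + 1) · segEntry P {a,b} (T ∖ {c₀})` (`pairSum_insert`: a map `g : T → {a,b}` is a map
`T ∖ {c₀} → {a,b}` plus the image of `c₀`, and the two choices contribute the factorial weights `(|g⁻¹ a| + 1)` and
`(|g⁻¹ b| + 1)`, which add up to `|T| + 1`).  In the zeon algebra this is the identity
`∂_{c₀}(R_a R_b) = (E + 2)(R̄_a R̄_b)` (`E` the Euler operator), i.e. the "dual-number" structure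
`(1 - y_{c₀})(1 + y_{c₀}) = 1`.  So all `C(h,2)` pair rows lie in the kernel of the surjective linear map
`θ : ℂ^r → ℂ^N`, `(θ x)_T = x_T - v(|T|+1)·x_{T∖c₀}` (`T ∋ c₀`), of dimension `r - N`, while the remaining rows (`∅` and the
singletons) span at most `h + 1` dimensions: `rank ≤ r - N + h + 1 < r`.

WHY IT MATTERS.  A design rule for every witness of the ∀h stubs of the line (S10ℤ, Z01, or any table): the `h` points
must not lie on a common coordinate hyperplane `{ξ_{c₀} = v}` for any bit `c₀` carrying `≥ h + 2` columns (all low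
bits).  For 0/1 designs (CONJECTURE Z01): no coordinate may belong to ALL supports.  It is the general-table companion
of the 0/1 no-go's `det_zoTable_eq_zero_of_parallel_edges` / `_of_twisted_rectangle` (p629307 / p630040), and like
them it is a relation that needs the nilpotency `y_{c₀}² = 0` (general affine hyperplanes `Σ λ_c ξ_c = 1` with two or
more nonzero `λ_c` do NOT starve: `h ≤ k` generic points always lie on one).

WHAT THIS IS NOT: no stub of the line is closed; a constraint on witnesses only; nothing on items 20172 / 19717,
crux stmt-ValiantsHypothesis-14610, or `VP` versus `VNP`.
-/

set_option linter.dupNamespace false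

namespace Summit.ValiantsHypothesis.ValiantsHypothesis.Theorems.BarrierLever.ChowBenchmarkHyperplane

open Finset Module
open Summit.ValiantsHypothesis.ValiantsHypothesis.Theorems.BarrierLever.MoorePeel
  (benchCols benchCols_downClosed windowStart_succ_le_two_pow windowStart_succ_eq_choose)
open Summit.ValiantsHypothesis.ValiantsHypothesis.Theorems.BarrierLever.ChowBenchmarkDual
  (segSum_empty segSum_singleton segSum_pair eq_windowStart_of_enumeration)

variable {h : ℕ}

noncomputable section

/-! ## 1. The pair segment sum and the insertion identity -/

/-- The pair segment sum `segEntry P {a,b} T` in powerset form (`segSum_pair`):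
`Σ_{d ⊆ T} |d|!·|T∖d|!·(∏_{c∈d} P a c)(∏_{c∈T∖d} P b c)`. -/
def pairSum (P : Fin h → Fin h → ℂ) (a b : Fin h) (T : Finset (Fin h)) : ℂ :=
  ∑ d ∈ T.powerset, (d.card.factorial : ℂ) * ((T \ d).card.factorial : ℂ) *
    ((∏ c ∈ d, P a c) * ∏ c ∈ T \ d, P b c)

/-- **The insertion identity.**  If both points have `c`-th coordinate `v` and `c ∉ T`, then
`pairSum P a b (insert c T) = v · (|T| + 2) · pairSum P a b T`. -/
theorem pairSum_insert (P : Fin h → Fin h → ℂ) (a b : Fin h) {c : Fin h} {T : Finset (Fin h)}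
    (hc : c ∉ T) {v : ℂ} (ha : P a c = v) (hb : P b c = v) :
    pairSum P a b (insert c T) = v * ((T.card : ℂ) + 2) * pairSum P a b T := by
  classical
  unfold pairSum
  rw [Finset.sum_powerset_insert hc, Finset.mul_sum, ← Finset.sum_add_distrib]
  refine Finset.sum_congr rfl fun d hd => ?_
  have hdT : d ⊆ T := Finset.mem_powerset.mp hd
  have hcd : c ∉ d := fun h' => hc (hdT h')
  have hcTd : c ∉ T \ d := fun h' => hc (Finset.mem_sdiff.mp h').1
  have e1 : insert c T \ d = insert c (T \ d) := Finset.insert_sdiff_of_notMem _ hcd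
  have e2 : insert c T \ insert c d = T \ d := by
    ext x
    simp only [Finset.mem_sdiff, Finset.mem_insert, not_or]
    constructor
    · rintro ⟨hx | hx, hxc, hxd⟩
      · exact absurd hx hxc
      · exact ⟨hx, hxd⟩
    · rintro ⟨hx, hxd⟩
      exact ⟨Or.inr hx, fun e => hc (e ▸ hx), hxd⟩
  rw [e1, e2, Finset.card_insert_of_notMem hcTd, Finset.card_insert_of_notMem hcd,
    Finset.prod_insert hcTd, Finset.prod_insert hcd, ha, hb, Nat.factorial_succ, Nat.factorial_succ]
  have hcardT : (T.card : ℂ) = ((T \ d).card : ℂ) + (d.card : ℂ) := by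
    exact_mod_cast (Finset.card_sdiff_add_card_eq_card hdT).symm
  rw [hcardT]
  push_cast
  ring

/-! ## 2. The segment-moment matrix and its rows of size `≤ 2` -/

/-- The segment-moment matrix of the benchmark layout at the table `P` for the row enumeration `u`
(the matrix of the line's `SegmentMeanValueAt h`, verbatim). -/
def segMatrix (r : ℕ) (P : Fin h → Fin h → ℂ) (u : Fin r → Finset (Fin h)) : Matrix (Fin r) (Fin r) ℂ :=
  Matrix.of fun i j : Fin r =>
    ∑ g : (↥(benchCols h r j) → ↥(u i)), (∏ c : ↥(benchCols h r j), P (g c) c) *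
      ∏ a : ↥(u i), ((Finset.univ.filter fun c : ↥(benchCols h r j) => g c = a).card.factorial : ℂ)

/-- The `h + 1` "small" row vectors: the `∅`-row `[T = ∅]` and the singleton rows `|T|!·∏_{c∈T} P a c`. -/
def smallRow (r : ℕ) (P : Fin h → Fin h → ℂ) : Option (Fin h) → (Fin r → ℂ)
  | none => fun j => if benchCols h r j = ∅ then 1 else 0
  | some a => fun j => ((benchCols h r j).card.factorial : ℂ) * ∏ c ∈ benchCols h r j, P a c

/-- Row `∅` of the segment-moment matrix is the small row `[T = ∅]`. -/
theorem segMatrix_row_empty {r : ℕ} (P : Fin h → Fin h → ℂ) (u : Fin r → Finset (Fin h)) {i : Fin r}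
    (hi : u i = ∅) : (segMatrix r P u).row i = smallRow r P none := by
  classical
  funext j
  simp only [Matrix.row_apply, segMatrix, Matrix.of_apply, smallRow]
  rw [hi, segSum_empty P (benchCols h r j)]

/-- Row `{a}` of the segment-moment matrix is the small row `|T|!·∏_{c∈T} P a c`. -/
theorem segMatrix_row_singleton {r : ℕ} (P : Fin h → Fin h → ℂ) (u : Fin r → Finset (Fin h)) {i : Fin r}
    {a : Fin h} (hi : u i = {a}) : (segMatrix r P u).row i = smallRow r P (some a) := by
  classical
  funext j
  simp only [Matrix.row_apply, segMatrix, Matrix.of_apply, smallRow]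
  rw [hi, segSum_singleton P a (benchCols h r j)]

/-- Row `{a, b}` (`a ≠ b`) of the segment-moment matrix is `pairSum P a b`. -/
theorem segMatrix_row_pair {r : ℕ} (P : Fin h → Fin h → ℂ) (u : Fin r → Finset (Fin h)) {i : Fin r}
    {a b : Fin h} (hab : a ≠ b) (hi : u i = {a, b}) (j : Fin r) :
    segMatrix r P u i j = pairSum P a b (benchCols h r j) := by
  classical
  simp only [segMatrix, Matrix.of_apply]
  rw [hi, segSum_pair P a b hab (benchCols h r j)]
  rfl

/-! ## 3. The linear constraints satisfied by the pair rows -/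

section Theta

variable {r : ℕ} (hr : r ≤ 2 ^ h) (c₀ : Fin h) (v : ℂ)

/-- The columns containing the bit `c₀`. -/
abbrev ColsWith (r : ℕ) (c₀ : Fin h) : Type := {j : Fin r // c₀ ∈ benchCols h r j}

/-- For a column `T ∋ c₀`, the column `T ∖ {c₀}` (it exists: the benchmark columns are down-closed). -/
def drop (j : ColsWith (h := h) r c₀) : Fin r :=
  Classical.choose (benchCols_downClosed hr j.1 ((benchCols h r j.1).erase c₀) (Finset.erase_subset _ _))

/-- `drop j` is the column `T ∖ {c₀}` of the column `T = benchCols h r j ∋ c₀`. -/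
theorem benchCols_drop (j : ColsWith (h := h) r c₀) :
    benchCols h r (drop hr c₀ j) = (benchCols h r j.1).erase c₀ :=
  Classical.choose_spec (benchCols_downClosed hr j.1 ((benchCols h r j.1).erase c₀) (Finset.erase_subset _ _))

/-- The dropped column does not contain `c₀`. -/
theorem notMem_benchCols_drop (j : ColsWith (h := h) r c₀) : c₀ ∉ benchCols h r (drop hr c₀ j) := by
  rw [benchCols_drop]; exact Finset.notMem_erase _ _

/-- Re-inserting `c₀` into the dropped column gives the column back. -/
theorem insert_benchCols_drop (j : ColsWith (h := h) r c₀) :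
    insert c₀ (benchCols h r (drop hr c₀ j)) = benchCols h r j.1 := by
  rw [benchCols_drop]; exact Finset.insert_erase j.2

/-- The constraint map `θ : ℂ^r → ℂ^{columns ∋ c₀}`, `(θ x)_T = x_T - v·(|T|+1)·x_{T ∖ c₀}`. -/
def theta : (Fin r → ℂ) →ₗ[ℂ] (ColsWith (h := h) r c₀ → ℂ) where
  toFun x j := x j.1 - v * (((benchCols h r j.1).card : ℂ) + 1) * x (drop hr c₀ j)
  map_add' x y := by
    funext j
    simp only [Pi.add_apply]
    ring
  map_smul' s x := by
    funext j
    simp only [Pi.smul_apply, smul_eq_mul, RingHom.id_apply]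
    ring

/-- Unfolding `θ`. -/
theorem theta_apply (x : Fin r → ℂ) (j : ColsWith (h := h) r c₀) :
    theta hr c₀ v x j = x j.1 - v * (((benchCols h r j.1).card : ℂ) + 1) * x (drop hr c₀ j) := rfl

/-- `θ` is surjective (a vector supported on the columns `∋ c₀` is mapped to itself). -/
theorem theta_surjective : Function.Surjective (theta (h := h) hr c₀ v) := by
  classical
  intro e
  refine ⟨fun j => if hj : c₀ ∈ benchCols h r j then e ⟨j, hj⟩ else 0, ?_⟩
  funext j
  rw [theta_apply, dif_pos j.2, dif_neg (notMem_benchCols_drop hr c₀ j)]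
  simp

/-- Rank–nullity for `θ`: `#(columns ∋ c₀) + dim ker θ = r`. -/
theorem card_add_finrank_ker_theta :
    Fintype.card (ColsWith (h := h) r c₀) + finrank ℂ (LinearMap.ker (theta (h := h) hr c₀ v)) = r := by
  have e := LinearMap.finrank_range_add_finrank_ker (theta (h := h) hr c₀ v)
  rw [LinearMap.range_eq_top.mpr (theta_surjective hr c₀ v), finrank_top, finrank_fintype_fun_eq_card,
    finrank_fintype_fun_eq_card, Fintype.card_fin] at e
  exact e

/-- **Every pair row lies in `ker θ`** when the two points have `c₀`-th coordinate `v`. -/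
theorem pair_row_mem_ker (P : Fin h → Fin h → ℂ) (u : Fin r → Finset (Fin h)) {i : Fin r} {a b : Fin h}
    (hab : a ≠ b) (hi : u i = {a, b}) (ha : P a c₀ = v) (hb : P b c₀ = v) :
    (segMatrix r P u).row i ∈ LinearMap.ker (theta (h := h) hr c₀ v) := by
  classical
  rw [LinearMap.mem_ker]
  funext j
  rw [theta_apply, Pi.zero_apply, Matrix.row_apply, Matrix.row_apply,
    segMatrix_row_pair P u hab hi, segMatrix_row_pair P u hab hi, ← insert_benchCols_drop hr c₀ j,
    pairSum_insert P a b (notMem_benchCols_drop hr c₀ j) ha hb,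
    Finset.card_insert_of_notMem (notMem_benchCols_drop hr c₀ j)]
  push_cast
  ring

end Theta

/-! ## 4. The no-go -/

/-- **Coordinate-hyperplane starvation (matrix form).**  If all points of the table share their `c₀`-th coordinate and
at least `h + 2` of the `r ≤ 2^h` benchmark columns contain the bit `c₀`, then for every row enumeration `u` by sets of
size `≤ 2` the segment-moment matrix is singular (rank `≤ r - N + h + 1`). -/
theorem det_segMatrix_eq_zero_of_common_coordinate {r : ℕ} (hr : r ≤ 2 ^ h) (u : Fin r → Finset (Fin h))
    (hcard : ∀ i, (u i).card ≤ 2) (P : Fin h → Fin h → ℂ) (c₀ : Fin h) (v : ℂ) (hP : ∀ a, P a c₀ = v)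
    (hN : h + 2 ≤ (Finset.univ.filter fun j : Fin r => c₀ ∈ benchCols h r j).card) :
    (segMatrix r P u).det = 0 := by
  classical
  by_contra hdet
  set M := segMatrix r P u with hM
  have hU : IsUnit M := (Matrix.isUnit_iff_isUnit_det M).mpr (isUnit_iff_ne_zero.mpr hdet)
  have hli : LinearIndependent ℂ M.row := Matrix.linearIndependent_rows_of_isUnit hU
  let K : Submodule ℂ (Fin r → ℂ) :=
    LinearMap.ker (theta (h := h) hr c₀ v) ⊔ Submodule.span ℂ (Set.range (smallRow r P))
  have hrows : ∀ i, M.row i ∈ K := by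
    intro i
    rcases MoorePeel.eq_empty_or_singleton_or_pair (u i) (hcard i) with h0 | ⟨a, ha⟩ | ⟨a, b, hab, habi⟩
    · refine Submodule.mem_sup_right (Submodule.subset_span ⟨none, ?_⟩)
      rw [hM, segMatrix_row_empty P u h0]
    · refine Submodule.mem_sup_right (Submodule.subset_span ⟨some a, ?_⟩)
      rw [hM, segMatrix_row_singleton P u ha]
    · exact Submodule.mem_sup_left (pair_row_mem_ker hr c₀ v P u (ne_of_lt hab) habi (hP a) (hP b))
  have hspan : Submodule.span ℂ (Set.range M.row) ≤ K :=
    Submodule.span_le.mpr (by rintro _ ⟨i, rfl⟩; exact hrows i)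
  have h1 : finrank ℂ (Submodule.span ℂ (Set.range M.row)) = r := by
    rw [finrank_span_eq_card hli, Fintype.card_fin]
  have h2 : finrank ℂ K ≤ finrank ℂ (LinearMap.ker (theta (h := h) hr c₀ v)) +
      finrank ℂ (Submodule.span ℂ (Set.range (smallRow r P))) :=
    Submodule.finrank_add_le_finrank_add_finrank _ _
  have h3 : finrank ℂ (Submodule.span ℂ (Set.range (smallRow r P))) ≤ h + 1 := by
    have := finrank_range_le_card (R := ℂ) (smallRow r P)
    rw [Fintype.card_option, Fintype.card_fin] at this
    exact this
  have h4 := card_add_finrank_ker_theta hr c₀ v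
  have h5 : Fintype.card (ColsWith (h := h) r c₀) =
      (Finset.univ.filter fun j : Fin r => c₀ ∈ benchCols h r j).card := Fintype.card_subtype _
  have h6 : finrank ℂ (Submodule.span ℂ (Set.range M.row)) ≤ finrank ℂ K := Submodule.finrank_mono hspan
  omega

/-- **Coordinate-hyperplane starvation — the line's form.**  For every injective enumeration `u` of exactly the subsets of
`Fin h` of size `≤ 2` (so `r = 1 + h + C(h,2) ≤ 2^h`), every bit `c₀` carried by at least `h + 2` benchmark columns, and
every point table whose points all have the same `c₀`-th coordinate, the segment-moment matrix of the benchmark layout —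
the matrix of `SegmentMeanValueAt h` in `Cruxes/ChowBenchmarkPairs/Lines/moore_peel.lean` — has determinant `0`:
such a table is never a witness of `stub_segmentMeanValue` / `stub_s10` / `stub_zeroOneDesign`. -/
theorem det_eq_zero_of_common_coordinate {r : ℕ} (u : Fin r → Finset (Fin h)) (hu : Function.Injective u)
    (hcard : ∀ i, (u i).card ≤ 2) (hsurj : ∀ S : Finset (Fin h), S.card ≤ 2 → ∃ i, u i = S)
    (P : Fin h → Fin h → ℂ) (c₀ : Fin h) (v : ℂ) (hP : ∀ a, P a c₀ = v)
    (hN : h + 2 ≤ (Finset.univ.filter fun j : Fin r => c₀ ∈ benchCols h r j).card) :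
    (Matrix.of fun i j : Fin r =>
      ∑ g : (↥(benchCols h r j) → ↥(u i)), (∏ c : ↥(benchCols h r j), P (g c) c) *
        ∏ a : ↥(u i), ((Finset.univ.filter fun c : ↥(benchCols h r j) => g c = a).card.factorial : ℂ)).det = 0 := by
  have hr : r ≤ 2 ^ h := by
    rw [eq_windowStart_of_enumeration u hu hcard hsurj]
    exact windowStart_succ_le_two_pow h
  exact det_segMatrix_eq_zero_of_common_coordinate hr u hcard P c₀ v hP hN

/-! ## 5. The lowest bit: the rule bites at every height `h ≥ 5` -/

/-- The number of odd naturals below `r` is `r / 2`. -/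
theorem card_range_filter_odd (r : ℕ) : ((Finset.range r).filter fun j => j % 2 = 1).card = r / 2 := by
  induction r with
  | zero => simp
  | succ n ih =>
    rw [Finset.range_add_one, Finset.filter_insert]
    split_ifs with hn
    · rw [Finset.card_insert_of_notMem (by simp), ih]
      omega
    · rw [ih]
      omega

/-- The benchmark columns containing the bit `0` are the odd codes: `⌊r/2⌋` of them. -/
theorem card_cols_with_bit_zero {r : ℕ} (hh : 0 < h) :
    (Finset.univ.filter fun j : Fin r => (⟨0, hh⟩ : Fin h) ∈ benchCols h r j).card = r / 2 := by
  have e : ∀ j : Fin r, ((⟨0, hh⟩ : Fin h) ∈ benchCols h r j) ↔ (j : ℕ) % 2 = 1 := by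
    intro j
    simp [MoorePeel.benchCols, Nat.testBit_zero]
  calc (Finset.univ.filter fun j : Fin r => (⟨0, hh⟩ : Fin h) ∈ benchCols h r j).card
      = (Finset.univ.filter fun j : Fin r => (j : ℕ) % 2 = 1).card := by
          rw [Finset.filter_congr (fun j _ => e j)]
    _ = ∑ j : Fin r, (if (j : ℕ) % 2 = 1 then 1 else 0) := Finset.card_filter _ _
    _ = ∑ j ∈ Finset.range r, (if j % 2 = 1 then 1 else 0) :=
          Fin.sum_univ_eq_sum_range (fun j => if j % 2 = 1 then 1 else 0) r
    _ = ((Finset.range r).filter fun j => j % 2 = 1).card := (Finset.card_filter _ _).symm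
    _ = r / 2 := card_range_filter_odd r

/-- **Coordinate-hyperplane starvation at the lowest bit: every height `h ≥ 5`.**  If all `h` points of the table
have the same `0`-th coordinate (`P a 0 = v` for all `a`; `v = 0` allowed), the segment-moment matrix of the benchmark
layout is singular — for every `h ≥ 5` and every injective enumeration of the rows (corank `≥ ⌊r/2⌋ - h - 1 ≥ 1`). -/
theorem det_eq_zero_of_common_zeroth_coordinate (hh : 5 ≤ h) {r : ℕ} (u : Fin r → Finset (Fin h))
    (hu : Function.Injective u) (hcard : ∀ i, (u i).card ≤ 2)
    (hsurj : ∀ S : Finset (Fin h), S.card ≤ 2 → ∃ i, u i = S)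
    (P : Fin h → Fin h → ℂ) (v : ℂ) (hP : ∀ a, P a ⟨0, by omega⟩ = v) :
    (Matrix.of fun i j : Fin r =>
      ∑ g : (↥(benchCols h r j) → ↥(u i)), (∏ c : ↥(benchCols h r j), P (g c) c) *
        ∏ a : ↥(u i), ((Finset.univ.filter fun c : ↥(benchCols h r j) => g c = a).card.factorial : ℂ)).det = 0 := by
  apply det_eq_zero_of_common_coordinate u hu hcard hsurj P ⟨0, by omega⟩ v hP
  rw [card_cols_with_bit_zero (by omega), eq_windowStart_of_enumeration u hu hcard hsurj,
    windowStart_succ_eq_choose, Nat.choose_two_right]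
  have h4 : h * 4 ≤ h * (h - 1) := Nat.mul_le_mul_left h (by omega)
  have h5 : h * 4 / 2 ≤ h * (h - 1) / 2 := Nat.div_le_div_right h4
  have h6 : h * 4 / 2 = 2 * h := by omega
  omega

/-! ## 6. The quantitative form: `rank ≤ r − N + h + 1` (appended, val-np-p4 g20) -/

/-- **Coordinate-hyperplane starvation, rank form.**  Under the hypotheses of
`det_segMatrix_eq_zero_of_common_coordinate` but WITHOUT the condition `h + 2 ≤ N`: the rank of the segment-moment matrix
plus the number `N` of benchmark columns containing the shared bit `c₀` is at most `r + h + 1`, i.e. `corank ≥ N − h − 1`.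
Numerically (kit j308240 / j308241, h ≤ 34, bits 0, k−2, k−1) this bound is attained with equality. -/
theorem rank_segMatrix_add_card_le_of_common_coordinate {r : ℕ} (hr : r ≤ 2 ^ h) (u : Fin r → Finset (Fin h))
    (hcard : ∀ i, (u i).card ≤ 2) (P : Fin h → Fin h → ℂ) (c₀ : Fin h) (v : ℂ) (hP : ∀ a, P a c₀ = v) :
    (segMatrix r P u).rank + (Finset.univ.filter fun j : Fin r => c₀ ∈ benchCols h r j).card ≤ r + (h + 1) := by
  classical
  set M := segMatrix r P u with hM
  let K : Submodule ℂ (Fin r → ℂ) :=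
    LinearMap.ker (theta (h := h) hr c₀ v) ⊔ Submodule.span ℂ (Set.range (smallRow r P))
  have hrows : ∀ i, M.row i ∈ K := by
    intro i
    rcases MoorePeel.eq_empty_or_singleton_or_pair (u i) (hcard i) with h0 | ⟨a, ha⟩ | ⟨a, b, hab, habi⟩
    · refine Submodule.mem_sup_right (Submodule.subset_span ⟨none, ?_⟩)
      rw [hM, segMatrix_row_empty P u h0]
    · refine Submodule.mem_sup_right (Submodule.subset_span ⟨some a, ?_⟩)
      rw [hM, segMatrix_row_singleton P u ha]
    · exact Submodule.mem_sup_left (pair_row_mem_ker hr c₀ v P u (ne_of_lt hab) habi (hP a) (hP b))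
  have hspan : Submodule.span ℂ (Set.range M.row) ≤ K :=
    Submodule.span_le.mpr (by rintro _ ⟨i, rfl⟩; exact hrows i)
  have h1 : M.rank = finrank ℂ (Submodule.span ℂ (Set.range M.row)) := Matrix.rank_eq_finrank_span_row M
  have h2 : finrank ℂ K ≤ finrank ℂ (LinearMap.ker (theta (h := h) hr c₀ v)) +
      finrank ℂ (Submodule.span ℂ (Set.range (smallRow r P))) :=
    Submodule.finrank_add_le_finrank_add_finrank _ _
  have h3 : finrank ℂ (Submodule.span ℂ (Set.range (smallRow r P))) ≤ h + 1 := by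
    have := finrank_range_le_card (R := ℂ) (smallRow r P)
    rw [Fintype.card_option, Fintype.card_fin] at this
    exact this
  have h4 := card_add_finrank_ker_theta hr c₀ v
  have h5 : Fintype.card (ColsWith (h := h) r c₀) =
      (Finset.univ.filter fun j : Fin r => c₀ ∈ benchCols h r j).card := Fintype.card_subtype _
  have h6 : finrank ℂ (Submodule.span ℂ (Set.range M.row)) ≤ finrank ℂ K := Submodule.finrank_mono hspan
  omega

/-! ## 7. The degenerate case of an unused coordinate (appended, val-np-p4 g20) -/

/-- **An unused coordinate kills the table** (rule R4z, the value-`0` case of the hyperplane rule without any counting hypothesis): if no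
point has a nonzero `c`-th coordinate and some benchmark column contains the bit `c`, that column of the segment-moment matrix is zero. -/
theorem det_eq_zero_of_unused_coordinate {r : ℕ} (u : Fin r → Finset (Fin h)) (P : Fin h → Fin h → ℂ) (c : Fin h)
    (hP : ∀ a, P a c = 0) (j : Fin r) (hj : c ∈ benchCols h r j) :
    (Matrix.of fun i j : Fin r =>
      ∑ g : (↥(benchCols h r j) → ↥(u i)), (∏ c : ↥(benchCols h r j), P (g c) c) *
        ∏ a : ↥(u i), ((Finset.univ.filter fun c : ↥(benchCols h r j) => g c = a).card.factorial : ℂ)).det = 0 := by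
  classical
  refine Matrix.det_eq_zero_of_column_eq_zero j fun i => ?_
  rw [Matrix.of_apply]
  refine Finset.sum_eq_zero fun g _ => ?_
  rw [Finset.prod_eq_zero (Finset.mem_univ (⟨c, hj⟩ : ↥(benchCols h r j))) (hP _), zero_mul]

end

end Summit.ValiantsHypothesis.ValiantsHypothesis.Theorems.BarrierLever.ChowBenchmarkHyperplane
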